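import Summits.QuantumAdvantage.QuantumAdvantage.Theorems.SupportDialResidueCertificateG

/-! # SupportDial residue certificate — part H (decomp-qadv-lens-1 g7, node «ResidueDial» rev 5)

§7c part 2 + §8b: the dictionary (`iterE_eq`, `core`, `signTwist_sum_eq`), `signTwistLaw2`, and the FINAL THEOREM `halfDegreeLaw2_holds : SupportDial.HalfDegreeLaw2` (item 32140). -/

set_option linter.dupNamespace false
set_option linter.style.longLine false
set_option linter.unusedVariables false

open Finset
open Literature.Computability.QuantumComplexity.RingHLF
open Literature.Computability.MetaComplexity.Smolensky (CubeFn mono lowDeg)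
open Summit.QuantumAdvantage.AdviceFreeQNC0

namespace Summit.QuantumAdvantage.QuantumAdvantage.Theorems.SupportDialResidueCertificate

section SignTwist
variable {k : ℕ}

/-! ### §7c-B The dictionary: ring definitions ↦ automaton -/
/-- Prefix count of a Boolean predicate on `Fin k`: `#{j < i : Q j}`. -/
def pc (Q : Fin k → Bool) (i : ℕ) : ℕ := ∑ j : Fin k, if j.val < i ∧ Q j = true then 1 else 0
/-- ResidueDial helper `pc_zero` (lens-1 g7 ResidueDial certificate; see the enclosing section docstring). -/
theorem pc_zero (Q : Fin k → Bool) : pc Q 0 = 0 := by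
  unfold pc; simp
/-- ResidueDial helper `pc_succ` (lens-1 g7 ResidueDial certificate; see the enclosing section docstring). -/
theorem pc_succ (Q : Fin k → Bool) {i : ℕ} (hi : i < k) :
    pc Q (i + 1) = pc Q i + (if Q ⟨i, hi⟩ = true then 1 else 0) := by
  unfold pc
  have hpt : ∀ j : Fin k, (if j.val < i + 1 ∧ Q j = true then 1 else 0 : ℕ) =
      (if j.val < i ∧ Q j = true then 1 else 0) + (if j = ⟨i, hi⟩ then (if Q j = true then 1 else 0) else 0) := by
    intro j
    by_cases h1 : j.val < i
    · have h2 : j ≠ ⟨i, hi⟩ := fun h => by rw [h] at h1; exact lt_irrefl _ h1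
      rw [if_neg h2, add_zero]
      by_cases hq : Q j = true
      · rw [if_pos ⟨by omega, hq⟩, if_pos ⟨h1, hq⟩]
      · rw [if_neg (fun h => hq h.2), if_neg (fun h => hq h.2)]
    · by_cases h2 : j = ⟨i, hi⟩
      · subst h2
        have e1 : ¬ ((⟨i, hi⟩ : Fin k).val < i ∧ Q ⟨i, hi⟩ = true) := fun h => h1 h.1
        rw [if_neg e1, if_pos rfl, zero_add]
        by_cases hq : Q ⟨i, hi⟩ = true
        · rw [if_pos ⟨Nat.lt_succ_self i, hq⟩, if_pos hq]
        · rw [if_neg (fun h => hq h.2), if_neg hq]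
      · have h3 : ¬ j.val < i + 1 := fun h => by
          rcases Nat.lt_succ_iff_lt_or_eq.1 h with h | h
          · exact h1 h
          · exact h2 (Fin.ext h)
        rw [if_neg (fun h => h3 h.1), if_neg (fun h => h1 h.1), if_neg h2]
  rw [Finset.sum_congr rfl fun j _ => hpt j, Finset.sum_add_distrib, Finset.sum_ite_eq' univ (⟨i, hi⟩ : Fin k)]
  simp
/-- ResidueDial helper `pc_full` (lens-1 g7 ResidueDial certificate; see the enclosing section docstring). -/
theorem pc_full (Q : Fin k → Bool) : pc Q k = (univ.filter fun j : Fin k => Q j = true).card := by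
  unfold pc
  rw [Finset.card_filter]
  refine Finset.sum_congr rfl fun j _ => ?_
  simp only [j.isLt, true_and]
/-- Partial rotation number: `Σ_{j<i} (−1)^{#ones ≤ j}`. -/
def rotp (β : Fin k → Bool) (i : ℕ) : ZMod 3 :=
  ∑ j : Fin k, if j.val < i then (-1 : ZMod 3) ^ pc β (j.val + 1) else 0
/-- ResidueDial helper `rotp_zero` (lens-1 g7 ResidueDial certificate; see the enclosing section docstring). -/
theorem rotp_zero (β : Fin k → Bool) : rotp β 0 = 0 := by
  unfold rotp; simp
/-- ResidueDial helper `rotp_succ` (lens-1 g7 ResidueDial certificate; see the enclosing section docstring). -/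
theorem rotp_succ (β : Fin k → Bool) {i : ℕ} (hi : i < k) :
    rotp β (i + 1) = rotp β i + (-1 : ZMod 3) ^ pc β (i + 1) := by
  unfold rotp
  have hpt : ∀ j : Fin k, (if j.val < i + 1 then (-1 : ZMod 3) ^ pc β (j.val + 1) else 0) =
      (if j.val < i then (-1 : ZMod 3) ^ pc β (j.val + 1) else 0) +
        (if j = ⟨i, hi⟩ then (-1 : ZMod 3) ^ pc β (j.val + 1) else 0) := by
    intro j
    by_cases h1 : j.val < i
    · have h2 : j ≠ ⟨i, hi⟩ := fun h => by rw [h] at h1; exact lt_irrefl _ h1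
      rw [if_pos (by omega), if_pos h1, if_neg h2, add_zero]
    · by_cases h2 : j = ⟨i, hi⟩
      · subst h2; rw [if_pos (Nat.lt_succ_self i), if_neg h1, if_pos rfl, zero_add]
      · have h3 : ¬ j.val < i + 1 := fun h => by
          rcases Nat.lt_succ_iff_lt_or_eq.1 h with h | h
          · exact h1 h
          · exact h2 (Fin.ext h)
        rw [if_neg h3, if_neg h1, if_neg h2, add_zero]
  rw [Finset.sum_congr rfl fun j _ => hpt j, Finset.sum_add_distrib, Finset.sum_ite_eq' univ (⟨i, hi⟩ : Fin k)]
  simp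
/-- ResidueDial helper `rotp_full` (lens-1 g7 ResidueDial certificate; see the enclosing section docstring). -/
theorem rotp_full (β : Fin k → Bool) : rotp β k = rot3 β := by
  unfold rotp rot3
  refine Finset.sum_congr rfl fun i _ => ?_
  rw [if_pos i.isLt, pc]
  congr 1
  rw [Finset.card_filter]
  refine Finset.sum_congr rfl fun j _ => ?_
  have : (j.val < i.val + 1 ∧ β j = true) ↔ (j ≤ i ∧ β j = true) := by
    rw [Nat.lt_succ_iff, Fin.le_iff_val_le_val]
  exact if_congr this rfl rfl
/-- `(−1)^n` read through the parity of `n`. -/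
theorem sgn3_cast (n : ℕ) : sgn3 (n : ZMod 2) = (-1 : ZMod 3) ^ n := by
  unfold sgn3
  rcases Nat.even_or_odd n with ⟨m, rfl⟩ | ⟨m, rfl⟩
  · rw [if_pos, Even.neg_one_pow ⟨m, rfl⟩]
    push_cast
    exact (by decide : ∀ x : ZMod 2, x + x = 0) _
  · rw [if_neg, Odd.neg_one_pow ⟨m, rfl⟩]
    push_cast
    rw [two_mul]
    have h : ∀ x : ZMod 2, x + x + 1 ≠ 0 := by decide
    exact h _

/-- Trajectory predicates: `W`-events and `V`-events along the walk from `s₀`. -/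
def QW (β : Fin k → Bool) (s₀ : St) : Fin k → Bool := fun j => β j && (iter β j.val s₀).2
/-- ResidueDial helper `QV` (lens-1 g7 ResidueDial certificate; see the enclosing section docstring). -/
def QV (β : Fin k → Bool) (s₀ : St) : Fin k → Bool := fun j => decide (iter β (j.val + 1) s₀ = (true, true))

/-- **The extended fold computes the walk statistics.** -/
theorem iterE_eq (β : Fin k → Bool) (s₀ : St) : ∀ i, i ≤ k →
    iterE β i (initE s₀) =
      (iter β i s₀, (pc (QV β s₀) i : ZMod 2), (pc (QW β s₀) i : ZMod 4), (pc β i : ZMod 2), rotp β i)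
  | 0, _ => by
    rw [iterE_zero, iter_zero, pc_zero, pc_zero, pc_zero, rotp_zero]
    simp [initE]
  | i + 1, hi => by
    have hik : i < k := by omega
    rw [iterE_succ β hik, iterE_eq β s₀ i (by omega), rotp_succ β hik, pc_succ (QV β s₀) hik,
      pc_succ (QW β s₀) hik, pc_succ β hik, iter_succ β hik]
    have hV : (QV β s₀ ⟨i, hik⟩ = true) ↔ tstep (β ⟨i, hik⟩) (iter β i s₀) = (true, true) := by
      unfold QV; rw [decide_eq_true_iff, iter_succ β hik]
    have hW : (QW β s₀ ⟨i, hik⟩ = true) ↔ (β ⟨i, hik⟩ && (iter β i s₀).2) = true := Iff.rfl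
    unfold fstep
    refine Prod.ext rfl (Prod.ext ?_ (Prod.ext ?_ (Prod.ext ?_ ?_)))
    · show (pc (QV β s₀) i : ZMod 2) + ind (decide (tstep (β ⟨i, hik⟩) (iter β i s₀) = (true, true))) = _
      rw [ind_decide]; push_cast
      congr 1
      exact if_congr hV.symm rfl rfl
    · show (pc (QW β s₀) i : ZMod 4) + bit4 (β ⟨i, hik⟩ && (iter β i s₀).2) = _
      unfold bit4; push_cast
      rfl
    · show (pc β i : ZMod 2) + ind (β ⟨i, hik⟩) = _
      unfold ind; push_cast; rfl
    · show rotp β i + sgn3 ((pc β i : ZMod 2) + ind (β ⟨i, hik⟩)) = rotp β i + (-1 : ZMod 3) ^ (pc β i + if β ⟨i, hik⟩ = true then 1 else 0)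
      congr 1
      rw [← sgn3_cast]; congr 1; unfold ind; push_cast; rfl

/-- `wtAnd` of a trajectory is the full `W`-count. -/
theorem wtAnd_kernelVec (β : Fin k → Bool) (s₀ : St) : wtAnd β (kernelVec β s₀) = pc (QW β s₀) k := by
  rw [pc_full]; unfold wtAnd QW kernelVec
  congr 1
  refine Finset.filter_congr fun j _ => ?_
  rw [Bool.and_eq_true]

/-- `edgesIn` of a CLOSED trajectory is the full `V`-count. -/
theorem edgesIn_kernelVec (β : Fin k → Bool) (s₀ : St) (hcl : iter β k s₀ = s₀) :
    edgesIn (kernelVec β s₀) = pc (QV β s₀) k := by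
  rw [pc_full]; unfold edgesIn QV kernelVec
  congr 1
  refine Finset.filter_congr fun j _ => ?_
  have h1 : iter β (nxt j).val s₀ = iter β (j.val + 1) s₀ := by
    show iter β ((j.val + 1) % k) s₀ = _
    by_cases hj : j.val + 1 < k
    · rw [Nat.mod_eq_of_lt hj]
    · rw [show j.val + 1 = k by omega, Nat.mod_self, iter_zero, hcl]
  have h2 : (iter β (j.val + 1) s₀).1 = (iter β j.val s₀).2 := iter_succ_fst β j.isLt s₀
  rw [h1, decide_eq_true_iff, Prod.ext_iff, h2]

/-- The sign bit of the zero vector vanishes. -/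
theorem signBit_zero_vec (x : Fin k → Bool) : signBit x (fun _ => false) = 0 := by
  unfold signBit edgesIn wtAnd; simp

/-- **Kernel collapse** on the odd class: `Σ_v [v ∈ K(β)] c(v) = c(J(β))` when `c(0) = 0`. -/
theorem sum_kernel_collapse (hk : 3 ≤ k) (β : Fin k → Bool) (hrefl : reflBit (List.ofFn β) = true)
    (c : (Fin k → Bool) → ZMod 2) (hc0 : c (fun _ => false) = 0) :
    (∑ v : Fin k → Bool, ind (kerB β v) * c v) = c (kernelVec β (fixVec (sigmaSum (List.ofFn β)))) := by
  have hJ : kernelVec β (fixVec (sigmaSum (List.ofFn β))) ≠ fun _ => false :=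
    kernelVec_fixVec_ne_zero hk β hrefl
  have hpt : ∀ v : Fin k → Bool, ind (kerB β v) * c v =
      (if v = (fun _ => false) then c v else 0) +
        (if v = kernelVec β (fixVec (sigmaSum (List.ofFn β))) then c v else 0) := by
    intro v
    unfold kerB
    by_cases hv : InKernel β v
    · rw [decide_eq_true hv, ind_true, one_mul]
      rcases (kernel_odd hk β hrefl v).1 hv with h | h
      · rw [if_pos h, if_neg (by rw [h]; exact hJ.symm), add_zero]
      · rw [if_neg (by rw [h]; exact hJ), if_pos h, zero_add]
    · rw [decide_eq_false hv, ind_false, zero_mul]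
      have h1 : v ≠ fun _ => false := by intro h; rw [h] at hv; exact hv (inKernel_zero β)
      have h2 : v ≠ kernelVec β (fixVec (sigmaSum (List.ofFn β))) := by
        intro h; rw [h] at hv; exact hv ((kernel_odd hk β hrefl _).2 (Or.inr rfl))
      rw [if_neg h1, if_neg h2, add_zero]
  rw [Finset.sum_congr rfl fun v _ => hpt v, Finset.sum_add_distrib, Finset.sum_ite_eq' univ,
    Finset.sum_ite_eq' univ]
  simp [hc0]

/-- Arithmetic of the sign bit: `(V + W/2) mod 2 = V + [W ≡ 2 (4)]` in `𝔽₂` for even `W`. -/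
theorem cast_sign (V W : ℕ) (hW : Even W) :
    ((((V + W / 2) % 2 : ℕ)) : ZMod 2) = (V : ZMod 2) + (if ((W : ℕ) : ZMod 4) = 2 then 1 else 0) := by
  obtain ⟨a, rfl⟩ := hW
  rw [show a + a = 2 * a by ring, Nat.mul_div_cancel_left a (by norm_num), ZMod.natCast_mod, Nat.cast_add]
  congr 1
  rcases Nat.even_or_odd a with ⟨c, rfl⟩ | ⟨c, rfl⟩
  · have h4 : ((2 * (c + c) : ℕ) : ZMod 4) ≠ 2 := by
      rw [show 2 * (c + c) = 4 * c by ring, Nat.cast_mul, show ((4 : ℕ) : ZMod 4) = 0 by decide, zero_mul]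
      decide
    rw [if_neg h4]
    push_cast
    exact (by decide : ∀ x : ZMod 2, x + x = 0) _
  · have h4 : ((2 * (2 * c + 1) : ℕ) : ZMod 4) = 2 := by
      rw [show 2 * (2 * c + 1) = 4 * c + 2 by ring, Nat.cast_add, Nat.cast_mul,
        show ((4 : ℕ) : ZMod 4) = 0 by decide, zero_mul, zero_add]
      decide
    rw [if_pos h4]
    push_cast
    exact (by decide : ∀ x : ZMod 2, 2 * x + 1 = 1) _

/-- Number of ones plus number of zeros. -/
theorem ones_add_zeros (β : Fin k → Bool) :
    pc β k + (univ.filter fun b : Fin k => β b = false).card = k := by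
  rw [pc_full]
  have h := Finset.card_filter_add_card_filter_not (s := (univ : Finset (Fin k))) (fun b : Fin k => β b = true)
  rw [Finset.card_univ, Fintype.card_fin] at h
  have h2 : (univ.filter fun b : Fin k => ¬ β b = true) = univ.filter fun b : Fin k => β b = false :=
    Finset.filter_congr fun b _ => by simp
  rw [h2] at h
  exact h

/-- **Per-word read-out**: for odd `k ≥ 3`, the kernel/sign sum of `β` is the read-out functional of
the extended fold, summed over the three non-zero start states. -/
theorem core (hk : 3 ≤ k) (hko : Odd k) (β : Fin k → Bool) :
    (∑ v : Fin k → Bool, ind (lamB β && kerB β v) * ((signBit β v : ℕ) : ZMod 2)) =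
      Gsum fun s₀ => G s₀ (iterE β k (initE s₀)) := by
  have hE : ∀ s₀, iterE β k (initE s₀) =
      (iter β k s₀, (pc (QV β s₀) k : ZMod 2), (pc (QW β s₀) k : ZMod 4), (pc β k : ZMod 2), rotp β k) :=
    fun s₀ => iterE_eq β s₀ k le_rfl
  by_cases hodd : oddZ β = true
  · -- odd class
    have hzodd : (univ.filter fun b : Fin k => β b = false).card % 2 = 1 := by
      unfold oddZ at hodd; exact of_decide_eq_true hodd
    have hrefl : reflBit (List.ofFn β) = true := by
      rw [reflBit_ofFn_iff]; exact Nat.odd_iff.2 hzodd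
    have hpar : (pc β k : ZMod 2) = 0 := by
      have h1 := ones_add_zeros β
      obtain ⟨m, hm⟩ := hko
      have : pc β k % 2 = 0 := by omega
      rw [← ZMod.natCast_mod, this, Nat.cast_zero]
    have hfix : ∀ s₀ : St, iter β k s₀ = s₀ ↔ (s₀ = (false, false) ∨ s₀ = fixVec (sigmaSum (List.ofFn β))) := by
      intro s₀; rw [iter_length, monodromy_eq_dict, hrefl]; exact dict_true_fixed_iff _ s₀
    -- left-hand side: collapse the kernel sum
    have hL : (∑ v : Fin k → Bool, ind (lamB β && kerB β v) * ((signBit β v : ℕ) : ZMod 2)) =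
        (if rot3 β ≠ 0 then ((signBit β (kernelVec β (fixVec (sigmaSum (List.ofFn β)))) : ℕ) : ZMod 2) else 0) := by
      have : ∀ v : Fin k → Bool, ind (lamB β && kerB β v) * ((signBit β v : ℕ) : ZMod 2) =
          ind (lamB β) * (ind (kerB β v) * ((signBit β v : ℕ) : ZMod 2)) := fun v => by rw [ind_and, mul_assoc]
      rw [Finset.sum_congr rfl fun v _ => this v, ← Finset.mul_sum,
        sum_kernel_collapse hk β hrefl _ (by rw [signBit_zero_vec]; simp)]
      unfold lamB; rw [hodd, Bool.true_and, ind_decide]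
      split_ifs <;> simp
    rw [hL]
    -- right-hand side: the non-closing start states vanish, the closing one reads the sign bit
    have hvan : ∀ s₀ : St, s₀ ≠ (false, false) → s₀ ≠ fixVec (sigmaSum (List.ofFn β)) →
        G s₀ (iterE β k (initE s₀)) = 0 := by
      intro s₀ h0 h1
      rw [hE s₀]; unfold G
      rw [if_neg]
      rintro ⟨h, -, -⟩
      rcases (hfix s₀).1 h with h' | h'
      · exact h0 h'
      · exact h1 h'
    have hmain : G (fixVec (sigmaSum (List.ofFn β))) (iterE β k (initE (fixVec (sigmaSum (List.ofFn β))))) =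
        (if rot3 β ≠ 0 then ((signBit β (kernelVec β (fixVec (sigmaSum (List.ofFn β)))) : ℕ) : ZMod 2) else 0) := by
      set s₁ := fixVec (sigmaSum (List.ofFn β)) with hs₁
      have hcl : iter β k s₁ = s₁ := (hfix s₁).2 (Or.inr rfl)
      have hmono : monodromy (List.ofFn β) s₁ = s₁ := by rw [← iter_length]; exact hcl
      have hK : InKernel β (kernelVec β s₁) := inKernel_kernelVec hk β hmono
      have hWeven : Even (wtAnd β (kernelVec β s₁)) := even_wtAnd_of_inKernel hK
      rw [hE s₁]; unfold G
      simp only [hcl, hpar, rotp_full, true_and]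
      by_cases hrot : rot3 β ≠ 0
      · rw [if_pos hrot, if_pos hrot]
        unfold signBit
        rw [cast_sign _ _ hWeven, edgesIn_kernelVec β s₁ hcl, wtAnd_kernelVec]
      · rw [if_neg hrot, if_neg hrot]
    -- assemble over the three start states
    have h3 : ∀ S : ZMod 3, fixVec S = (true, false) ∨ fixVec S = (true, true) ∨ fixVec S = (false, true) := by
      decide
    unfold Gsum
    beta_reduce
    rcases h3 (sigmaSum (List.ofFn β)) with h | h | h
    · rw [hvan (true, true) (by decide) (by rw [h]; decide), hvan (false, true) (by decide) (by rw [h]; decide),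
        add_zero, add_zero, ← h, hmain]
    · rw [hvan (true, false) (by decide) (by rw [h]; decide), hvan (false, true) (by decide) (by rw [h]; decide),
        zero_add, add_zero, ← h, hmain]
    · rw [hvan (true, false) (by decide) (by rw [h]; decide), hvan (true, true) (by decide) (by rw [h]; decide),
        zero_add, zero_add, ← h, hmain]
  · -- even class: both sides vanish
    have hL : (∑ v : Fin k → Bool, ind (lamB β && kerB β v) * ((signBit β v : ℕ) : ZMod 2)) = 0 := by
      refine Finset.sum_eq_zero fun v _ => ?_
      unfold lamB; rw [Bool.eq_false_iff.2 hodd, Bool.false_and, Bool.false_and, ind_false, zero_mul]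
    have hpar : (pc β k : ZMod 2) ≠ 0 := by
      have h1 := ones_add_zeros β
      obtain ⟨m, hm⟩ := hko
      have hz : (univ.filter fun b : Fin k => β b = false).card % 2 = 0 := by
        have : ¬ ((univ.filter fun b : Fin k => β b = false).card % 2 = 1) := fun h => hodd (by
          unfold oddZ; exact decide_eq_true h)
        omega
      have : pc β k % 2 = 1 := by omega
      rw [← ZMod.natCast_mod, this, Nat.cast_one]; exact one_ne_zero
    have hvan : ∀ s₀ : St, G s₀ (iterE β k (initE s₀)) = 0 := by
      intro s₀; rw [hE s₀]; unfold G
      rw [if_neg]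
      rintro ⟨-, h, -⟩
      exact hpar h
    rw [hL]; unfold Gsum; beta_reduce; rw [hvan, hvan, hvan]; simp

/-- Fiberwise: the word sum of the read-out is the read-out against the parity vector. -/
theorem fiber (s₀ : St) (k : ℕ) :
    (∑ β : Fin k → Bool, G s₀ (iterE β k (initE s₀))) = ∑ u : ES, G s₀ u * P k s₀ u := by
  unfold P
  simp_rw [Finset.mul_sum]
  rw [Finset.sum_comm]
  refine Finset.sum_congr rfl fun β _ => ?_
  simp_rw [mul_ite, mul_one, mul_zero]
  rw [Finset.sum_ite_eq]
  simp

/-- ResidueDial helper `Gsum_add` (lens-1 g7 ResidueDial certificate; see the enclosing section docstring). -/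
theorem Gsum_add (F₁ F₂ : St → ZMod 2) : Gsum (fun s => F₁ s + F₂ s) = Gsum F₁ + Gsum F₂ := by
  unfold Gsum; ring

/-- ResidueDial helper `Gsum_sum` (lens-1 g7 ResidueDial certificate; see the enclosing section docstring). -/
theorem Gsum_sum {ι : Type*} (s : Finset ι) (F : ι → St → ZMod 2) :
    (∑ i ∈ s, Gsum (F i)) = Gsum fun s₀ => ∑ i ∈ s, F i s₀ := by
  unfold Gsum
  rw [Finset.sum_add_distrib, Finset.sum_add_distrib]

/-- **The sign-twist sum as an automaton read-out** (odd `k ≥ 3`). -/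
theorem signTwist_sum_eq (hk : 3 ≤ k) (hko : Odd k) :
    (∑ β : Fin k → Bool, ∑ v : Fin k → Bool, ind (lamB β && kerB β v) * ((signBit β v : ℕ) : ZMod 2)) =
      Gsum fun s₀ => ∑ u : ES, G s₀ u * P k s₀ u := by
  rw [Finset.sum_congr rfl fun β _ => core hk hko β, Gsum_sum]
  unfold Gsum
  beta_reduce
  rw [fiber, fiber, fiber]

/-! ### §7c-C The sign-twist law -/

/-- ResidueDial helper `signTwistAt_of_two_le` (lens-1 g7 ResidueDial certificate; see the enclosing section docstring). -/
theorem signTwistAt_of_two_le (r : ℕ) (hr : 2 ≤ r) : SignTwistAt r := by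
  unfold SignTwistAt
  rw [signTwist_sum_eq (by omega) ⟨r + 1, by ring⟩]
  obtain ⟨j, hj⟩ : ∃ j, 2 * r + 3 = 2 * j + 7 := ⟨r - 2, by omega⟩
  rw [hj]
  unfold Gsum
  beta_reduce
  rw [P_stable (true, false) (by decide) j, P_stable (true, true) (by decide) j,
    P_stable (false, true) (by decide) j]
  have h := readout_seven
  unfold Gsum at h
  exact h

/-- **The sign-twist law**: `N_{2r+3}` is odd for every `r ≥ 1`. -/
theorem signTwistLaw2 : SignTwistLaw2 := by
  intro r hr
  by_cases h : r = 1
  · subst h; exact signTwistAt_one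
  · exact signTwistAt_of_two_le r (by omega)


end SignTwist

/-! ## §8b FINAL THEOREMS (rev 5): the live crux 32140 and every grade of the half-degree law -/

/-- **`SupportDial.HalfDegreeLaw2` (tree item stmt-QuantumAdvantage-32140) HOLDS**: on the bare `k`-cycle, `k ≥ 5`,
no `𝔽₂`-polynomial strategy of coordinate degree `≤ (k−3)/2` wins the ring-HLF game on the whole odd class. -/
theorem halfDegreeLaw2_holds : Summit.QuantumAdvantage.QuantumAdvantage.Theses.SupportDial.HalfDegreeLaw2 :=
  halfDegreeLaw2_of_signTwist signTwistLaw2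

/-- The same, unfolded to the node's `SmallRingLosesDeg`. -/
theorem smallRingLosesDeg_all (k r : ℕ) (h5 : 5 ≤ k) (hk : 2 * r + 3 ≤ k) : SmallRingLosesDeg k r :=
  (halfDegreeLaw2_iff.1 halfDegreeLaw2_holds) k r h5 hk

/-- The threshold law and every piece of the certificate decomposition now hold outright. -/
theorem oddThresholdLaw2_holds : OddThresholdLaw2 := oddThreshold_of_signTwist signTwistLaw2

/-- ResidueDial helper `assembly_inputs_hold` (lens-1 g7 ResidueDial certificate; see the enclosing section docstring). -/
theorem assembly_inputs_hold : MomentLaw2 ∧ SignTwistLaw2 ∧ YStepLaw2 := ⟨momentLaw2, signTwistLaw2, yStepLaw2⟩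

end Summit.QuantumAdvantage.QuantumAdvantage.Theorems.SupportDialResidueCertificate
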